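import Summits.ABC.IUTFork.LDHGenuineHullRegimeSlack
import Summits.ABC.IUTFork.LDHGenuineTowerArithPerImage
import HarnessLib

/-!
# The fork at [IUTchIII] Corollary 3.12, L-DH level, READING (P): the CONTENTFUL form of what the crux asserts per point —
# `Cor312PerImageAtDatum P l` implies an effective SZPIRO-TYPE inequality with NO height-independent additive constant
# (abc-iut cell, crux ThetaPartII = stmt-ABC-19678, registered stub `stub_cor312PerImage` (iii-P); honest-scope record)

Record-only PROOF file (D-0012) of the abc-iut cell (WAVE-3 discharge seat abc-iut-c312-d1, gen 6); TAKES NO SIDE on [IUTchIII]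
Cor. 3.12 or on the (U)/(P) readings, asserts nothing about any point. Mochizuki, *Inter-universal Teichmüller theory IV*
(RIMS Apr. 2020 = PRIMS **57** (2021)), Thm. 1.10 proof Steps (v)–(viii) p. 27–30: the printed route bounds the Step (viii) term
`log(𝔰^≤)` (support primes below `e*_mod·l`) by the PRIME NUMBER THEOREM (`(4/3)·e*_mod·l`; the cell's kernel form `(20/3)·log(d*·l)·π(d*·l)`
inside `B_III(P,l)`), which is what makes the resulting display `(1/6)·log q ≤ … + 20·(d*·l + η)` CONTENT-FREE below
`log q ≈ 120·d*·l` (this seat's `LDHGenuineHullRegimeTrivialRange` / `…ContentFree`). AT A GIVEN DATUM no prime number theorem is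
needed: the support primes `T(I)` are a specific finite set with `#T(I)·log 2 ≤ 2·d_mod·(log-diff + log 𝔣^{∤{2,l}}) + log(30·l)`
(abc-iut-S3 `sum_log_supportPrimes_le_pinned`; `PointDict.card_supportPrimes_filter_le`). Feeding THAT count instead of `π(d*·l)`
into abc-iut-S7's explicit per-image Step (v) estimate (`DHData.hullEstimatePerImageOf_ofInput_explicit`, every input, reading (P):
no slot residue) and the pinned Step (ii)/(iii) tower bounds (abc-iut-S1/S-d1/S3/L5-t15: `ndeg_differentDivisor_le`,
`sum_log_supportPrimes_le_pinned`, `R4_towerFact`) gives, at EVERY genuine datum of EVERY admissible `(P, l)`, `l ≥ 7`: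

* `PointDict.hullEstimatePerImageOf_countForm` — `T.HullEstimatePerImageOf (B_#(P,l))` with the PNT-FREE constant
  `B_#(P,l) := (l+1)/4·{(1+4/l)·(L + 2·log l + 21) + (4/l)·(2·d_mod·L + log(30·l)) + (20/3)·log(d*·l)·(2·d_mod·L + log(30·l))/log 2}`,
  `L := log-diff + log 𝔣^{∤{2,l}}`, `d* = 2^12·3^3·5·d_mod` — UNCONDITIONAL (no (R4) hypothesis left, no slot-constancy);
  `PointDict.hullVolumePerImageAtDatum_countForm` (the `∀ T` form);
* **`PointDict.szpiro_of_cor312PerImageAtDatum`** — `Cor22.Cor312PerImageAtDatum P l →` (for any datum `T` at `(P,l)`)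
  `((l+1)/24 − 1/(2l))·log(q^{∤{2,l}}(λ)) ≤ B_#(P,l) + ((l+5)/4)·log π`;
* **`PointDict.szpiro_of_cor312PerImageAtDatum_linear`** — the same solved as an effective Szpiro-type inequality LINEAR in `L` with
  explicit coefficients and NO term growing like `d*·l`:
  `(1/6 − 2/(l(l+1)))·log(q^{∤{2,l}}(λ)) ≤ (2 + 20·d_mod·log(d*·l) + 8·d_mod/l)·L + (10·log(d*·l) + 5)·(4 + log l) + 26 + 2·log π`
  (crude but honest roundings; see the proof).

READING (for the planners; a statement about OUR typed objects). The (P)-line crux `stub_cor312PerImage` asserts at each admissible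
`(P, l)` (whenever a datum exists — abc-iut-L5-t7 `ThetaPartII.stub_thetaData`: always) an EFFECTIVE SZPIRO-TYPE INEQUALITY WITH CONTENT AT
EVERY HEIGHT: multiplicative constant `(2 + 20·d_mod·log(d*·l) + 8·d_mod/l)/(1/6 − 2/(l(l+1)))` on `log-diff + log-cond`
(`≈ 2.3·10³` at `d_mod = 1`, `l = 7`, after the crude roundings of this file; `→ 6·(2 + 20·d_mod·log(d*·l))` as `l` grows), additive
constant `O(log(d*·l)·log l)` — in contrast with the printed display, whose additive `20·d*·l` swamps every curve of height `< 10⁸`.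
Consequences stated plainly: (1) a kernel REFUTATION of `stub_cor312PerImage` at an explicit `(P, l)` needs a point `λ` violating this
inequality, i.e. of Szpiro-type ratio `log q^{∤{2,l}} / (log-diff + log-cond)` beyond `≈ 10³·d_mod·log(d*·l)` by THIS route (none is known:
the largest known Szpiro ratios are `< 9`); the EXACT per-datum threshold (abc-iut-c312-3's content-integer volume) is far smaller (`≈ 12`), still above every known
curve; (2) a PROOF of the stub proves that effective Szpiro bound. Neither is an in-cell target; the stub stays the disputed content.
HONEST SCOPE: constants are the cell's typed Step (ii)/(iii)/(v) bounds, not optimised; nothing about print's intended argument.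
[cite: Mochizuki2012, IUTchIV Thm. 1.10 proof Steps (ii)–(viii) p. 24–30] [cite: DupuyHilado2025, §4.7, §4.11–4.12]
[claim: Mochizuki2012, status: disputed] for every IUT quotation. PROOF-ONLY: no definitions, no new `Prop`.
-/

noncomputable section

namespace Summit.ABC.IUTFork

open Literature.IUT.HodgeTheaters Literature.IUT.LogVolume NumberField IsDedekindDomain
open Literature.NumberTheory.DiophantineGeometry.GenEll
open scoped Nat.Prime

namespace PointDict

variable {P : NFPoint} {l : ℕ}

/-- `log((2^12·3^3·5·d)·l) ≥ 1` for `d, l ≥ 1` (`d*·l ≥ 552960 ≥ e`). [cite: Mochizuki2012, IUTchIV Thm. 1.10 p. 22] -/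
private theorem one_le_log_dstar_mul {d l : ℕ} (hd : 1 ≤ d) (hl : 1 ≤ l) :
    1 ≤ Real.log (((2 ^ 12 * 3 ^ 3 * 5 * d : ℕ) : ℝ) * l) := by
  have h1 : (552960 : ℝ) ≤ ((2 ^ 12 * 3 ^ 3 * 5 * d : ℕ) : ℝ) := by
    exact_mod_cast (by nlinarith : 552960 ≤ 2 ^ 12 * 3 ^ 3 * 5 * d)
  have h2 : (1 : ℝ) ≤ (l : ℝ) := by exact_mod_cast hl
  have h3 : Real.exp 1 ≤ ((2 ^ 12 * 3 ^ 3 * 5 * d : ℕ) : ℝ) * l := by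
    have he : Real.exp 1 < 3 := lt_trans Real.exp_one_lt_d9 (by norm_num)
    nlinarith
  rw [← Real.log_exp 1] 
  exact Real.log_le_log (Real.exp_pos 1) h3

/-- **The per-image hull estimate with the PNT-FREE constant `B_#(P, l)`** — reading (P), EVERY genuine Θ-volume datum `T` at an
admissible `(P, l)` (`λ ∈ U_P` minimally presented, `l ≥ 7`), NO hypothesis: abc-iut-S7's explicit per-image Step (v) constant with the
Step (viii) count bounded by the number of support primes (`#T(I) ≤ (2·d_mod·L + log(30·l))/log 2`) instead of `π(d*·l)`, and the pinned
Step (ii)/(iii) tower bounds. [cite: Mochizuki2012, IUTchIV Thm. 1.10 proof Steps (ii)–(viii) p. 24–30] [claim: Mochizuki2012, status: disputed] -/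
theorem hullEstimatePerImageOf_countForm (T : Cor22.ThetaVolumeDatumAt P l) (hP : P ∈ UP) (h7 : 7 ≤ l) :
    T.HullEstimatePerImageOf (((l : ℝ) + 1) / 4 *
      ((1 + 4 / (l : ℝ)) * (P.logDiff + Cor22.logCondAvoid P {2, l} + 2 * Real.log l + 21)
        + 4 / (l : ℝ) * (2 * (Cor22.dmod P : ℝ) * (P.logDiff + Cor22.logCondAvoid P {2, l}) + Real.log (2 * 3 * 5 * (l : ℝ)))
        + 20 / 3 * Real.log (((2 ^ 12 * 3 ^ 3 * 5 * Cor22.dmod P : ℕ) : ℝ) * l)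
          * ((2 * (Cor22.dmod P : ℝ) * (P.logDiff + Cor22.logCondAvoid P {2, l}) + Real.log (2 * 3 * 5 * (l : ℝ)))
              / Real.log 2))) := by
  classical
  letI := T.instFieldF; letI := T.instNumberFieldF; letI := T.instAlgebraF; letI := T.instFieldK
  letI := T.instNumberFieldK; letI := T.instAlgebraK; letI := T.instFieldFbar; letI := T.instAlgebraFbar
  letI := T.instAlgebraKFbar; letI := T.instIsElliptic
  have hU : P.InU := hP.1
  have hl1 : 1 ≤ l := by omega
  have hd : 1 ≤ Cor22.dmod P := Cor22.dmod_pos P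
  have hXl : ((T.I.X.l : ℕ) : ℝ) = (l : ℝ) := by exact_mod_cast T.isVolumeInputOf.l_eq
  haveI : IsGalois (fieldOfModuli T.E) T.K := T.isGalois_fieldOfModuli_K
  have hprimes : ∀ p ∈ T.I.supportPrimes, p.Prime := fun p hp => T.I.prime_of_mem_supportPrimes hp
  have hlmod : 0 ≤ Real.log (((2 ^ 12 * 3 ^ 3 * 5 * Cor22.dmod P : ℕ) : ℝ) * l) :=
    le_trans zero_le_one (one_le_log_dstar_mul hd hl1)
  -- abc-iut-S7: the per-image Step (v) estimate with explicit constant, EVERY input, (R4) by abc-iut-S1's tower fact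
  have h0 := DHData.hullEstimatePerImageOf_ofInput_explicit T.I (2 ^ 12 * 3 ^ 3 * 5 * Cor22.dmod P * l) hlmod
    (T.R4_towerFact hP)
  rw [hXl] at h0
  -- Step (ii): `A ≤ log 𝔡^K ≤ L + 2·log l + 21`
  have hA1 := sum_dite_localDegree_mul_differentOrd_le_ndeg (fieldOfModuli T.E) T.K T.I.σ T.I.supportPrimes hprimes
  have hA2 := T.ndeg_differentDivisor_le hU h7
  have hA : (∑ p ∈ T.I.supportPrimes, if hp : p.Prime then haveI : Fact p.Prime := ⟨hp⟩
        (∑ v : placesOver (fieldOfModuli T.E) p, (localDegree (fieldOfModuli T.E) v.1 : ℝ) *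
          differentOrd p ((T.I.σ.localFieldFamily p hp).k v)) / Module.finrank ℚ (fieldOfModuli T.E) * Real.log p
        else 0) ≤ P.logDiff + Cor22.logCondAvoid P {2, l} + 2 * Real.log l + 21 := hA1.trans hA2
  -- Step (iii): `B ≤ 2·d_mod·L + log(30·l)` and the support-prime COUNT (no prime number theorem)
  have hB := T.sum_log_supportPrimes_le_pinned hP
  have hcnt := card_supportPrimes_filter_le T hP (2 ^ 12 * 3 ^ 3 * 5 * Cor22.dmod P * l)
  refine hullEstimatePerImageOf_mono T h0 ?_
  have hc0 : (0 : ℝ) ≤ ((l : ℝ) + 1) / 4 := by positivity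
  have hl0 : (0 : ℝ) < l := by exact_mod_cast (lt_of_lt_of_le (by norm_num) h7)
  have hc1 : (0 : ℝ) ≤ 1 + 4 / (l : ℝ) := by positivity
  have hc2 : (0 : ℝ) ≤ 4 / (l : ℝ) := by positivity
  have hc3 : (0 : ℝ) ≤ 20 / 3 * Real.log (((2 ^ 12 * 3 ^ 3 * 5 * Cor22.dmod P : ℕ) : ℝ) * l) := by positivity
  refine mul_le_mul_of_nonneg_left ?_ hc0
  have t1 := mul_le_mul_of_nonneg_left hA hc1
  have t2 := mul_le_mul_of_nonneg_left hB hc2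
  have t3 := mul_le_mul_of_nonneg_left hcnt hc3
  linarith

/-- The `∀ T` form: **`Cor22.HullVolumePerImageAtDatum P l (B_#(P, l))`** at every admissible `(P, l)`, `l ≥ 7` — the (ii′-P) body
with the PNT-free constant. [cite: Mochizuki2012, IUTchIV Thm. 1.10 proof Steps (ii)–(viii) p. 24–30] [claim: Mochizuki2012, status: disputed] -/
theorem hullVolumePerImageAtDatum_countForm (hP : P ∈ UP) (h7 : 7 ≤ l) :
    Cor22.HullVolumePerImageAtDatum P l (((l : ℝ) + 1) / 4 *
      ((1 + 4 / (l : ℝ)) * (P.logDiff + Cor22.logCondAvoid P {2, l} + 2 * Real.log l + 21)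
        + 4 / (l : ℝ) * (2 * (Cor22.dmod P : ℝ) * (P.logDiff + Cor22.logCondAvoid P {2, l}) + Real.log (2 * 3 * 5 * (l : ℝ)))
        + 20 / 3 * Real.log (((2 ^ 12 * 3 ^ 3 * 5 * Cor22.dmod P : ℕ) : ℝ) * l)
          * ((2 * (Cor22.dmod P : ℝ) * (P.logDiff + Cor22.logCondAvoid P {2, l}) + Real.log (2 * 3 * 5 * (l : ℝ)))
              / Real.log 2))) :=
  fun T => hullEstimatePerImageOf_countForm T hP h7

/-- **THE CONTENTFUL NECESSARY CONDITION: `Cor312PerImageAtDatum P l` ⟹ an effective Szpiro-type inequality with the PNT-free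
constant.** For an admissible `(P, l)` (`λ ∈ U_P`, `l ≥ 7`) carrying a datum `T`: if [IUTchIII] Cor. 3.12 holds in reading (P) at the
Θ-data of `(P, l)`, then `((l+1)/24 − 1/(2l))·log(q^{∤{2,l}}(λ)) ≤ B_#(P,l) + ((l+5)/4)·log π` (abc-iut-S2's per-image squeeze
`Cor22.gap_le_at_perImage` + `PointDict.gap_eq`). HYPOTHESIS = the disputed crux; nothing asserted.
[cite: Mochizuki2012, IUTchIV Thm. 1.10 proof Steps (v)–(x) p. 27–32] [claim: Mochizuki2012, status: disputed] -/
theorem szpiro_of_cor312PerImageAtDatum (hP : P ∈ UP) (h7 : 7 ≤ l) (h : Cor22.Cor312PerImageAtDatum P l)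
    (T : Cor22.ThetaVolumeDatumAt P l) :
    (((l : ℝ) + 1) / 24 - 1 / (2 * l)) * Cor22.logQAvoid P {2, l} ≤
      ((l : ℝ) + 1) / 4 *
        ((1 + 4 / (l : ℝ)) * (P.logDiff + Cor22.logCondAvoid P {2, l} + 2 * Real.log l + 21)
          + 4 / (l : ℝ) * (2 * (Cor22.dmod P : ℝ) * (P.logDiff + Cor22.logCondAvoid P {2, l}) + Real.log (2 * 3 * 5 * (l : ℝ)))
          + 20 / 3 * Real.log (((2 ^ 12 * 3 ^ 3 * 5 * Cor22.dmod P : ℕ) : ℝ) * l)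
            * ((2 * (Cor22.dmod P : ℝ) * (P.logDiff + Cor22.logCondAvoid P {2, l}) + Real.log (2 * 3 * 5 * (l : ℝ)))
                / Real.log 2))
      + ThetaVolumeInput.archLogTheta l := by
  rw [← gap_eq T hP.1]
  exact Cor22.gap_le_at_perImage h (hullVolumePerImageAtDatum_countForm hP h7) T

/-- **The same, LINEAR in `L = log-diff + log-cond` with explicit coefficients and NO `d*·l`-sized constant**: for an admissible
`(P, l)`, `l ≥ 7`, carrying a datum, `Cor312PerImageAtDatum P l` implies
`(1/6 − 2/(l(l+1)))·log(q^{∤{2,l}}(λ)) ≤ (2 + 20·d_mod·log(d*·l) + 8·d_mod/l)·L + (10·log(d*·l) + 5)·(4 + log l) + 26 + 2·log π`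
(`((l+1)/4)·(1/6 − 2/(l(l+1))) = (l+1)/24 − 1/(2l)` exactly; roundings: `1 + 4/l ≤ 2`; `log(30·l) ≤ 5·log 2 + log l ≤ 4 + log l`;
`1/log 2 ≤ 1.45`; `(l+5)/4 ≤ 2·(l+1)/4`). CONTENT at every height: e.g. `d_mod = 1`, `l = 7` (`log(d*·l) ≈ 15.2`, `1/6 − 2/56 ≈ 0.131`):
`log q^{∤{2,7}}(λ) ≲ 7.64·(307·L + 960) ≈ 2.3·10³·L + 7.4·10³` — an effective Szpiro-type bound, versus the printed display's additive
`120·d*·l ≈ 4.6·10⁸` on `log q`.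
[cite: Mochizuki2012, IUTchIV Thm. 1.10 proof Steps (v)–(x) p. 27–32] [claim: Mochizuki2012, status: disputed] -/
theorem szpiro_of_cor312PerImageAtDatum_linear (hP : P ∈ UP) (h7 : 7 ≤ l) (h : Cor22.Cor312PerImageAtDatum P l)
    (T : Cor22.ThetaVolumeDatumAt P l) :
    (1 / 6 - 2 / ((l : ℝ) * ((l : ℝ) + 1))) * Cor22.logQAvoid P {2, l} ≤
      (2 + 20 * (Cor22.dmod P : ℝ) * Real.log (((2 ^ 12 * 3 ^ 3 * 5 * Cor22.dmod P : ℕ) : ℝ) * l)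
          + 8 * (Cor22.dmod P : ℝ) / l) * (P.logDiff + Cor22.logCondAvoid P {2, l})
        + (10 * Real.log (((2 ^ 12 * 3 ^ 3 * 5 * Cor22.dmod P : ℕ) : ℝ) * l) + 5) * (4 + Real.log l)
        + 26 + 2 * Real.log Real.pi := by
  have hmain := szpiro_of_cor312PerImageAtDatum hP h7 h T
  have hl7 : (7 : ℝ) ≤ l := by exact_mod_cast h7
  have hl0 : (0 : ℝ) < l := by linarith
  have hl1 : 1 ≤ l := by omega
  have hQ : 0 ≤ Cor22.logQAvoid P {2, l} := Cor22.logQAvoid_nonneg P _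
  have harch : ThetaVolumeInput.archLogTheta l = ((l : ℝ) + 5) / 4 * Real.log Real.pi := rfl
  rw [harch] at hmain
  -- the atoms
  set Λ : ℝ := Real.log (((2 ^ 12 * 3 ^ 3 * 5 * Cor22.dmod P : ℕ) : ℝ) * l) with hΛ
  set L : ℝ := P.logDiff + Cor22.logCondAvoid P {2, l} with hLdef
  set D : ℝ := (Cor22.dmod P : ℝ) with hDdef
  set X : ℝ := Real.log (2 * 3 * 5 * (l : ℝ)) with hXdef
  have hΛ0 : 0 ≤ Λ := le_trans zero_le_one (one_le_log_dstar_mul (Cor22.dmod_pos P) hl1)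
  have hL0 : 0 ≤ L := add_nonneg P.logDiff_nonneg (Cor22.logCondAvoid_nonneg P _)
  have hD1 : 1 ≤ D := by rw [hDdef]; exact_mod_cast Cor22.dmod_pos P
  have hD0 : 0 ≤ D := le_trans zero_le_one hD1
  have hlogl : 0 ≤ Real.log l := Real.log_nonneg (by linarith)
  have hpi0 : 0 ≤ Real.log Real.pi := Real.log_nonneg (by linarith [Real.pi_gt_three])
  have hlog2 : (0 : ℝ) < Real.log 2 := Real.log_pos (by norm_num)
  -- `log(30·l) ≤ 5·log 2 + log l ≤ 4 + log l`, `X ≥ 0`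
  have hX0 : 0 ≤ X := Real.log_nonneg (by linarith)
  have hX : X ≤ 4 + Real.log l := by
    have h32 : Real.log (2 * 3 * 5 * (l : ℝ)) ≤ Real.log ((2 : ℝ) ^ 5 * (l : ℝ)) :=
      Real.log_le_log (by positivity) (by nlinarith)
    have e : Real.log ((2 : ℝ) ^ 5 * (l : ℝ)) = 5 * Real.log 2 + Real.log l := by
      rw [Real.log_mul (by norm_num) hl0.ne', Real.log_pow]; push_cast; ring
    rw [e] at h32
    have h2 := Real.log_two_lt_d9
    rw [hXdef]
    linarith
  -- `1/log 2 ≤ 1.45`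
  have hinv2 : 1 / Real.log 2 ≤ 1.45 := by
    rw [div_le_iff₀ hlog2]; have := Real.log_two_gt_d9; linarith
  -- (a) `(1 + 4/l)·(L + 2 log l + 21) ≤ 2·(L + 2 log l + 21)`
  have h4l : 4 / (l : ℝ) ≤ 1 := by rw [div_le_one hl0]; linarith
  have h4l' : 0 ≤ 4 / (l : ℝ) := by positivity
  have ha : (1 + 4 / (l : ℝ)) * (L + 2 * Real.log l + 21) ≤ 2 * (L + 2 * Real.log l + 21) :=
    mul_le_mul_of_nonneg_right (by linarith) (by positivity)
  -- (b) `(4/l)·(2·D·L + X) ≤ (8·D/l)·L + (4 + log l)`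
  have hb : 4 / (l : ℝ) * (2 * D * L + X) ≤ 8 * D / l * L + (4 + Real.log l) := by
    have t : 4 / (l : ℝ) * X ≤ 1 * X := mul_le_mul_of_nonneg_right h4l hX0
    have e : 4 / (l : ℝ) * (2 * D * L + X) = 8 * D / l * L + 4 / (l : ℝ) * X := by ring
    rw [e]; linarith
  -- (c) `(20/3)·Λ·(2·D·L + X)/log 2 ≤ 20·D·Λ·L + 10·Λ·(4 + log l)`
  have hc : 20 / 3 * Λ * ((2 * D * L + X) / Real.log 2) ≤ 20 * (D * Λ * L) + 10 * (Λ * (4 + Real.log l)) := by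
    have hdiv : (2 * D * L + X) / Real.log 2 ≤ 1.45 * (2 * D * L + (4 + Real.log l)) := by
      rw [div_eq_mul_one_div]
      have hnum : 0 ≤ 2 * D * L + X := by positivity
      calc (2 * D * L + X) * (1 / Real.log 2)
          ≤ (2 * D * L + X) * 1.45 := mul_le_mul_of_nonneg_left hinv2 hnum
        _ ≤ (2 * D * L + (4 + Real.log l)) * 1.45 := mul_le_mul_of_nonneg_right (by linarith) (by norm_num)
        _ = 1.45 * (2 * D * L + (4 + Real.log l)) := by ring
    have t := mul_le_mul_of_nonneg_left hdiv (show (0 : ℝ) ≤ 20 / 3 * Λ by positivity)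
    have e : 20 / 3 * Λ * (1.45 * (2 * D * L + (4 + Real.log l))) = 58 / 3 * (D * Λ * L) + 29 / 3 * (Λ * (4 + Real.log l)) := by
      ring
    have hM1 : 0 ≤ D * Λ * L := by positivity
    have hM2 : 0 ≤ Λ * (4 + Real.log l) := by positivity
    linarith
  -- the bracket
  have hbr : (1 + 4 / (l : ℝ)) * (L + 2 * Real.log l + 21) + 4 / (l : ℝ) * (2 * D * L + X)
        + 20 / 3 * Λ * ((2 * D * L + X) / Real.log 2) ≤
      (2 + 8 * D / l) * L + 20 * (D * Λ * L) + 10 * (Λ * (4 + Real.log l)) + 5 * (4 + Real.log l) + 26 := by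
    have e : (2 + 8 * D / l) * L = 2 * L + 8 * D / l * L := by ring
    linarith
  -- (d) the archimedean term: `(l+5)/4 ≤ 2·(l+1)/4`
  have hc0 : (0 : ℝ) < ((l : ℝ) + 1) / 4 := by positivity
  have hdarch : ((l : ℝ) + 5) / 4 * Real.log Real.pi ≤ ((l : ℝ) + 1) / 4 * (2 * Real.log Real.pi) := by
    have : ((l : ℝ) + 5) / 4 ≤ ((l : ℝ) + 1) / 4 * 2 := by linarith
    calc ((l : ℝ) + 5) / 4 * Real.log Real.pi ≤ ((l : ℝ) + 1) / 4 * 2 * Real.log Real.pi :=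
        mul_le_mul_of_nonneg_right this hpi0
      _ = ((l : ℝ) + 1) / 4 * (2 * Real.log Real.pi) := by ring
  -- left side: `((l+1)/4)·(1/6 − 2/(l(l+1))) = (l+1)/24 − 1/(2l)` exactly
  have hleft : ((l : ℝ) + 1) / 4 * ((1 / 6 - 2 / ((l : ℝ) * ((l : ℝ) + 1))) * Cor22.logQAvoid P {2, l}) ≤
      (((l : ℝ) + 1) / 24 - 1 / (2 * l)) * Cor22.logQAvoid P {2, l} := by
    have hl1' : (0 : ℝ) < (l : ℝ) + 1 := by linarith
    have e : ((l : ℝ) + 1) / 4 * (1 / 6 - 2 / ((l : ℝ) * ((l : ℝ) + 1))) = ((l : ℝ) + 1) / 24 - 1 / (2 * l) := by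
      field_simp
      ring
    rw [← mul_assoc, e]
  -- assemble and cancel `(l+1)/4`
  have hR := mul_le_mul_of_nonneg_left hbr hc0.le
  have htot : ((l : ℝ) + 1) / 4 * ((1 / 6 - 2 / ((l : ℝ) * ((l : ℝ) + 1))) * Cor22.logQAvoid P {2, l}) ≤
      ((l : ℝ) + 1) / 4 * ((2 + 8 * D / l) * L + 20 * (D * Λ * L) + 10 * (Λ * (4 + Real.log l))
        + 5 * (4 + Real.log l) + 26 + 2 * Real.log Real.pi) := by
    have e : ((l : ℝ) + 1) / 4 * ((2 + 8 * D / l) * L + 20 * (D * Λ * L) + 10 * (Λ * (4 + Real.log l))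
          + 5 * (4 + Real.log l) + 26 + 2 * Real.log Real.pi)
        = ((l : ℝ) + 1) / 4 * ((2 + 8 * D / l) * L + 20 * (D * Λ * L) + 10 * (Λ * (4 + Real.log l))
          + 5 * (4 + Real.log l) + 26) + ((l : ℝ) + 1) / 4 * (2 * Real.log Real.pi) := by ring
    rw [e]
    linarith [hleft, hmain, hR, hdarch]
  have hfin := le_of_mul_le_mul_left htot hc0
  have e : (2 + 20 * D * Λ + 8 * D / l) * L + (10 * Λ + 5) * (4 + Real.log l) + 26 + 2 * Real.log Real.pi
      = (2 + 8 * D / l) * L + 20 * (D * Λ * L) + 10 * (Λ * (4 + Real.log l)) + 5 * (4 + Real.log l) + 26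
        + 2 * Real.log Real.pi := by ring
  rw [e]
  exact hfin

end PointDict

end Summit.ABC.IUTFork

end
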